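import Summits.CriticalPhenomena.Ising3DConformalLimit.Theses.InverseSquareTelemetry
import Summits.CriticalPhenomena.Ising3DConformalLimit.Theorems.InverseSquareTelemetryEtaBoundsFromTelemetryBarriers
import Literature.Probability.LatticeModels.CriticalTwoPointBounds
import HarnessLib

/-!
# `EtaBoundsFromTelemetry` (item stmt-CriticalPhenomena-4499), proved unconditionally

`theorem etaBoundsFromTelemetry_proof :
  Summit.CriticalPhenomena.Ising3DConformalLimit.Theses.InverseSquareTelemetry.EtaBoundsFromTelemetry`
(route `CriticalPhenomena/Ising3DConformalLimit/InverseSquareTelemetry`, support item; the a-priori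
half of the lattice Agmon–Murata–Pinchover asymptotics applied to `G = criticalTwoPoint 3`).
`exterior_bounds`: on `E = {s ≥ S₀}` (`s = ∑ xᵢ² = |x|₂²`) the barriers `s^{-p} ∓ A s^{-p-e'}`
(`2p = α₊(κ)`) and the weight `h = s^{-1/4}` of `…Barriers.lean` / `…Powers.lean` feed the tree's
`h`-transform comparison principle `Literature.Probability.LatticeModels.sub_le_super_of_hTransform`,
giving `m s^{-p} ≤ G ≤ M s^{-p}` on `E`; `powerBounds_of_telemetry` absorbs the finite region
`{s < S₀}`; `etaBoundsFromTelemetry_proof` supplies `G > 0`, `G ≤ C₀‖x‖⁻¹`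
(`criticalTwoPoint_bounds_holds`), `latticeLaplacianZd_three`, `√s^{-ε} = s^{-ε/2}` and
`‖x‖² ≤ s ≤ 3‖x‖²`. Method: Murata, Duke Math. J. 53 (1986); Pinchover, J. Differential Equations
111 (1994); on graphs Keller–Pinchover–Pogorzelski, J. Spectral Theory 10 (2020) §4.2.
Axioms: `propext`, `Classical.choice`, `Quot.sound`.
-/

noncomputable section

namespace Summit.CriticalPhenomena.Ising3DConformalLimit.Theorems.EtaBoundsFromTelemetry

open Literature.Probability.LatticeModels Finset Set Filter Topology

/-! ### The a-priori bounds on the exterior region -/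

/-- **A-priori bounds far out.** If `G > 0` on `ℤ³ ∖ {0}`, `G ≤ C₀ s^{-1/2}`, and `V = ΔG/G` obeys
`|s(x) V(x) - κ| ≤ C s(x)^{-e}` (`κ ≥ 0`, `e > 0`, `C ≥ 0`), then with `p = (1 + √(1+4κ))/4` (`2p = α₊(κ)`,
`2p(2p-1) = κ`) there are `S₀`, `0 < m`, `M` with `m s^{-p} ≤ G ≤ M s^{-p}` on `{s ≥ S₀}`: the barriers
`s^{-p} ∓ A s^{-p-e'}` and the weight `h = s^{-1/4}` feed the tree's `h`-transform comparison principle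
`sub_le_super_of_hTransform` on `E = {s ≥ S₀}` (boundary values on the finite shell
`∂E ⊆ {S₀/4 ≤ s < S₀}`, decay `G, w± = O(s^{-1/2}) = o(h)`). [folklore] -/
theorem exterior_bounds {κ e C C₀ : ℝ} (hκ : 0 ≤ κ) (he : 0 < e) (hC : 0 ≤ C) {G : Site 3 → ℝ}
    (hGpos : ∀ x : Site 3, x ≠ 0 → 0 < G x)
    (hGup : ∀ x : Site 3, x ≠ 0 → G x ≤ C₀ * (∑ i, ((x i : ℤ) : ℝ) ^ 2) ^ (-(1 / 2 : ℝ)))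
    (hT : ∀ x : Site 3, x ≠ 0 →
      |(∑ i, ((x i : ℤ) : ℝ) ^ 2) * (latticeLaplacianZd G x / G x) - κ| ≤
        C * (∑ i, ((x i : ℤ) : ℝ) ^ 2) ^ (-e)) :
    ∃ S₀ m M : ℝ, 0 < m ∧ ∀ x : Site 3, S₀ ≤ ∑ i, ((x i : ℤ) : ℝ) ^ 2 →
      m * (∑ i, ((x i : ℤ) : ℝ) ^ 2) ^ (-((1 + Real.sqrt (1 + 4 * κ)) / 4)) ≤ G x ∧
      G x ≤ M * (∑ i, ((x i : ℤ) : ℝ) ^ 2) ^ (-((1 + Real.sqrt (1 + 4 * κ)) / 4)) := by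
  obtain ⟨S, hS⟩ : ∃ S : Site 3 → ℝ, ∀ x, S x = ∑ i, ((x i : ℤ) : ℝ) ^ 2 := ⟨_, fun _ => rfl⟩
  simp only [← hS] at hGup hT ⊢
  have hS0 : S 0 = 0 := by rw [hS]; simp
  have hStend : Tendsto S cofinite atTop := by simpa only [← hS] using tendsto_sumSq_cofinite
  set r : ℝ := Real.sqrt (1 + 4 * κ) with hr
  have hr1 : 1 ≤ r := by
    simpa only [Real.sqrt_one] using Real.sqrt_le_sqrt (show (1 : ℝ) ≤ 1 + 4 * κ by linarith)
  have hrr : r ^ 2 = 1 + 4 * κ := Real.sq_sqrt (by linarith)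
  set p : ℝ := (1 + r) / 4 with hp
  have hp2 : 1 / 2 ≤ p := by rw [hp]; linarith
  have hp0 : 0 < p := by linarith
  have hκp : 2 * p * (2 * p - 1) = κ := by rw [hp]; linear_combination (1 / 4 : ℝ) * hrr
  set e' : ℝ := min e (1 / 4) / 2 with he'
  have he'0 : 0 < e' := by rw [he']; positivity
  have he'e : e' < e := by
    have : min e (1 / 4) ≤ e := min_le_left _ _
    rw [he']; linarith
  have he'4 : e' ≤ 1 / 8 := by
    have : min e (1 / 4) ≤ 1 / 4 := min_le_right _ _
    rw [he']; linarith
  set D : ℝ := 2 * e' * (4 * p + 2 * e' - 1) with hD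
  have hD0 : 0 < D := by
    have : 0 < 4 * p + 2 * e' - 1 := by linarith
    rw [hD]; positivity
  have hκq : 2 * (p + e') * (2 * (p + e') - 1) = κ + D := by rw [hD, ← hκp]; ring
  obtain ⟨Kp, hKp0, hLp⟩ := latticeLaplacianZd_rpow_neg hp0
  obtain ⟨Kq, hKq0, hLq⟩ := latticeLaplacianZd_rpow_neg (show 0 < p + e' by linarith)
  obtain ⟨Kh, hKh0, hLh⟩ := latticeLaplacianZd_rpow_neg (show (0 : ℝ) < 1 / 4 by norm_num)
  simp only [← hS] at hLp hLq hLh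
  simp only [hκq] at hLq
  simp only [hκp] at hLp
  set A : ℝ := 4 * (C + Kp + 1) / D with hA
  have hA0 : 0 < A := by rw [hA]; positivity
  have hAD : A * D = 4 * (C + Kp + 1) := by rw [hA]; field_simp
  have hev : ∀ᶠ s : ℝ in atTop, 16 ≤ s ∧ (A * Kq * s ^ (-(1 / 2 : ℝ)) ≤ 1 ∧
      (C * A * s ^ (-e) ≤ 1 ∧ (Kh * s ^ (-(1 / 2 : ℝ)) ≤ 1 / 8 ∧
      (C * s ^ (-e) ≤ 1 / 8 ∧ A * s ^ (-e') ≤ 1 / 2)))) :=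
    (eventually_ge_atTop 16).and ((eventually_mul_rpow_neg_le (by norm_num) _ one_pos).and
      ((eventually_mul_rpow_neg_le he _ one_pos).and
      ((eventually_mul_rpow_neg_le (by norm_num) _ (by norm_num)).and
      ((eventually_mul_rpow_neg_le he _ (by norm_num)).and
      (eventually_mul_rpow_neg_le he'0 _ (by norm_num))))))
  obtain ⟨S₁, hS₁⟩ := Filter.eventually_atTop.1 hev
  set S₀ : ℝ := 4 * max S₁ 16 with hS₀def
  have hS₀64 : 64 ≤ S₀ := by
    have : (16 : ℝ) ≤ max S₁ 16 := le_max_right _ _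
    rw [hS₀def]; linarith
  have hS₁S₀ : S₁ ≤ S₀ / 4 := by
    have : S₁ ≤ max S₁ 16 := le_max_left _ _
    rw [hS₀def]; linarith
  clear_value S₀ A D e' p r
  clear hev hS₀def hA hD he' hp hr hrr
  have adm : ∀ x : Site 3, S₀ / 4 ≤ S x → x ≠ 0 ∧ 1 ≤ S x ∧ 16 ≤ S x ∧
      A * S x ^ (-(p + e')) ≤ S x ^ (-p) / 2 ∧ A ≤ S x ^ e' ∧
      A * Kq * S x ^ (-(1 / 2 : ℝ)) ≤ 1 ∧ C * A * S x ^ (-e) ≤ 1 ∧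
      Kh * S x ^ (-(1 / 2 : ℝ)) ≤ 1 / 8 ∧ C * S x ^ (-e) ≤ 1 / 8 := by
    intro x hx
    obtain ⟨h16, h1, h2, h3, h4, h5⟩ := hS₁ (S x) (hS₁S₀.trans hx)
    have hs0 : 0 < S x := by linarith
    have hx0 : x ≠ 0 := by
      rintro rfl
      rw [hS0] at hx
      linarith
    refine ⟨hx0, by linarith, h16, ?_, ?_, h1, h2, h3, h4⟩
    · have hsplit : S x ^ (-(p + e')) = S x ^ (-e') * S x ^ (-p) := by
        rw [← Real.rpow_add hs0]; congr 1; ring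
      rw [hsplit, ← mul_assoc]
      have h0 : 0 ≤ S x ^ (-p) := Real.rpow_nonneg hs0.le _
      nlinarith
    · have hinv : S x ^ (-e') = (S x ^ e')⁻¹ := Real.rpow_neg hs0.le e'
      have hpos : 0 < S x ^ e' := Real.rpow_pos_of_pos hs0 _
      rw [hinv, ← div_eq_mul_inv, div_le_iff₀ hpos] at h5
      linarith
  obtain ⟨E, hE⟩ : ∃ E : Set (Site 3), E = {y : Site 3 | S₀ ≤ ∑ i, ((y i : ℤ) : ℝ) ^ 2} :=
    ⟨_, rfl⟩
  have hEmem : ∀ x, x ∈ E ↔ S₀ ≤ S x := fun x => by rw [hE, hS]; rfl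
  obtain ⟨V, hV⟩ : ∃ V : Site 3 → ℝ, ∀ x, V x = latticeLaplacianZd G x / G x := ⟨_, fun _ => rfl⟩
  have hEadm : ∀ x ∈ E ∪ zdOuterBoundary E, S₀ / 4 ≤ S x ∧ S x ≤ S₀ ∨ S₀ ≤ S x := by
    intro x hx
    rcases hx with hx | hx
    · exact Or.inr ((hEmem x).1 hx)
    · rw [hE] at hx
      obtain ⟨h1, h2⟩ := sumSq_of_mem_zdOuterBoundary hS₀64 hx
      rw [← hS] at h1 h2
      exact Or.inl ⟨h1, h2.le⟩
  clear hE
  have hEadm' : ∀ x ∈ E ∪ zdOuterBoundary E, S₀ / 4 ≤ S x := by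
    intro x hx
    rcases hEadm x hx with ⟨h, -⟩ | h
    · exact h
    · linarith
  have hVT : ∀ x : Site 3, x ≠ 0 → |S x * V x - κ| ≤ C * S x ^ (-e) := fun x hx => by
    rw [hV]; exact hT x hx
  have hsol : ∀ x : Site 3, x ≠ 0 → latticeLaplacianZd G x = V x * G x := fun x hx => by
    rw [hV, div_mul_cancel₀ _ (hGpos x hx).ne']
  -- (1) the weight `h = S^{-1/4}` is a positive supersolution on `E`
  have hpos : ∀ x ∈ E ∪ zdOuterBoundary E, 0 < (fun y => S y ^ (-(1 / 4 : ℝ))) x := by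
    intro x hx
    have : 0 < S x := by linarith [hEadm' x hx]
    exact Real.rpow_pos_of_pos this _
  have hsuper : ∀ x ∈ E, latticeLaplacianZd (fun y => S y ^ (-(1 / 4 : ℝ))) x ≤
      V x * (fun y => S y ^ (-(1 / 4 : ℝ))) x := by
    intro x hx
    have hx4 : S₀ / 4 ≤ S x := hEadm' x (Or.inl hx)
    obtain ⟨hx0, hs1, hs16, -, -, -, -, c3, c4⟩ := adm x hx4
    exact weight_arith hs1 hκ (hLh x hs16) (hVT x hx0) (by linarith)
  -- (2) the barriers
  have hbar : ∀ x ∈ E,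
      latticeLaplacianZd (fun y => S y ^ (-p) - A * S y ^ (-(p + e'))) x ≤
          V x * (S x ^ (-p) - A * S x ^ (-(p + e'))) ∧
        V x * (S x ^ (-p) + A * S x ^ (-(p + e'))) ≤
          latticeLaplacianZd (fun y => S y ^ (-p) + A * S y ^ (-(p + e'))) x := by
    intro x hx
    have hx4 : S₀ / 4 ≤ S x := hEadm' x (Or.inl hx)
    obtain ⟨hx0, hs1, hs16, -, hAu, c1, c2, -, -⟩ := adm x hx4
    obtain ⟨hsub, hadd⟩ := latticeLaplacianZd_sub_const_mul (fun y => S y ^ (-p))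
      (fun y => S y ^ (-(p + e'))) A x
    rw [hsub, hadd]
    refine barrier_arith hs1 hA0.le hC hAu (hLp x hs16) (hLq x hs16) (hVT x hx0) ?_
    have h1 : S x ^ (e' - 1 / 2) ≤ 1 := Real.rpow_le_one_of_one_le_of_nonpos hs1 (by linarith)
    have h2 : S x ^ (e' - e) ≤ 1 := Real.rpow_le_one_of_one_le_of_nonpos hs1 (by linarith)
    have h3 : Kp * S x ^ (e' - 1 / 2) ≤ Kp := by nlinarith
    have h4 : C * S x ^ (e' - e) ≤ C := by nlinarith
    linarith
  have hF : {y : Site 3 | S y ≤ S₀}.Finite := by simpa only [← hS] using finite_sumSq_le S₀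
  have hbdryF : ∀ y ∈ zdOuterBoundary E, y ∈ {y : Site 3 | S y ≤ S₀} ∧ S₀ / 4 ≤ S y := by
    intro y hy
    rcases hEadm y (Or.inr hy) with ⟨h1, h2⟩ | h
    · exact ⟨h2, h1⟩
    · exact absurd ((hEmem y).2 h) hy.1
  have hwpos : ∀ x : Site 3, S₀ / 4 ≤ S x →
      0 < S x ^ (-p) - A * S x ^ (-(p + e')) ∧
      S x ^ (-p) - A * S x ^ (-(p + e')) ≤ S x ^ (-p) ∧
      S x ^ (-p) ≤ S x ^ (-p) + A * S x ^ (-(p + e')) ∧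
      S x ^ (-p) + A * S x ^ (-(p + e')) ≤ 2 * S x ^ (-(1 / 2 : ℝ)) := by
    intro x hx
    obtain ⟨-, hs1, -, hAq, -⟩ := adm x hx
    have hs0 : 0 < S x := by linarith
    have h0 : 0 < S x ^ (-p) := Real.rpow_pos_of_pos hs0 _
    have h1 : 0 ≤ A * S x ^ (-(p + e')) := mul_nonneg hA0.le (Real.rpow_nonneg hs0.le _)
    have h2 : S x ^ (-p) ≤ S x ^ (-(1 / 2 : ℝ)) :=
      Real.rpow_le_rpow_of_exponent_le hs1 (by linarith)
    refine ⟨?_, ?_, ?_, ?_⟩ <;> linarith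
  -- (3) upper bound: `G ≤ M w₊` on `E`
  obtain ⟨M, hM0, hM⟩ := exists_le_mul_on_finite hF G (fun y => S y ^ (-p) - A * S y ^ (-(p + e')))
  have hupper : ∀ x ∈ E, G x ≤ M * (S x ^ (-p) - A * S x ^ (-(p + e'))) := by
    refine sub_le_super_of_hTransform (d := 3) (by norm_num) (E := E) (V := V) (u := G)
      (w := fun y => M * (S y ^ (-p) - A * S y ^ (-(p + e'))))
      (h := fun y => S y ^ (-(1 / 4 : ℝ))) hpos hsuper ?_ ?_ ?_ ?_
    · intro x hx
      obtain ⟨hx0, -⟩ := adm x (hEadm' x (Or.inl hx))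
      rw [hsol x hx0]
    · intro x hx
      rw [latticeLaplacianZd_const_mul]
      have h := (hbar x hx).1
      calc M * latticeLaplacianZd (fun y => S y ^ (-p) - A * S y ^ (-(p + e'))) x
          ≤ M * (V x * (S x ^ (-p) - A * S x ^ (-(p + e')))) := mul_le_mul_of_nonneg_left h hM0.le
        _ = V x * (M * (S x ^ (-p) - A * S x ^ (-(p + e')))) := by ring
    · intro y hy
      obtain ⟨hyF, hy4⟩ := hbdryF y hy
      exact hM y hyF (hwpos y hy4).1
    · intro ε hε
      have hev' : ∀ᶠ x in cofinite, |C₀| * S x ^ (-(1 / 4 : ℝ)) ≤ ε :=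
        hStend.eventually (eventually_mul_rpow_neg_le (by norm_num) |C₀| hε)
      filter_upwards [hev'] with x hx hxE
      have hx4 : S₀ / 4 ≤ S x := hEadm' x (Or.inl hxE)
      obtain ⟨hx0, hs1, -⟩ := adm x hx4
      have hs0 : 0 < S x := by linarith
      have hw0 := (hwpos x hx4).1
      have hq : 0 ≤ S x ^ (-(1 / 4 : ℝ)) := Real.rpow_nonneg hs0.le _
      have hsplit : S x ^ (-(1 / 2 : ℝ)) = S x ^ (-(1 / 4 : ℝ)) * S x ^ (-(1 / 4 : ℝ)) := by
        rw [← Real.rpow_add hs0]; norm_num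
      calc G x - M * (S x ^ (-p) - A * S x ^ (-(p + e'))) ≤ G x := by
            have : 0 ≤ M * (S x ^ (-p) - A * S x ^ (-(p + e'))) := by positivity
            linarith
        _ ≤ C₀ * S x ^ (-(1 / 2 : ℝ)) := hGup x hx0
        _ ≤ |C₀| * S x ^ (-(1 / 2 : ℝ)) :=
            mul_le_mul_of_nonneg_right (le_abs_self _) (Real.rpow_nonneg hs0.le _)
        _ = |C₀| * S x ^ (-(1 / 4 : ℝ)) * S x ^ (-(1 / 4 : ℝ)) := by rw [hsplit, mul_assoc]
        _ ≤ ε * S x ^ (-(1 / 4 : ℝ)) := mul_le_mul_of_nonneg_right hx hq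
  -- (4) lower bound: `m w₋ ≤ G` on `E`
  obtain ⟨M₂, hM₂0, hM₂⟩ := exists_le_mul_on_finite hF (fun y => S y ^ (-p) + A * S y ^ (-(p + e'))) G
  have hlower : ∀ x ∈ E, M₂⁻¹ * (S x ^ (-p) + A * S x ^ (-(p + e'))) ≤ G x := by
    refine sub_le_super_of_hTransform (d := 3) (by norm_num) (E := E) (V := V)
      (u := fun y => M₂⁻¹ * (S y ^ (-p) + A * S y ^ (-(p + e')))) (w := G)
      (h := fun y => S y ^ (-(1 / 4 : ℝ))) hpos hsuper ?_ ?_ ?_ ?_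
    · intro x hx
      rw [latticeLaplacianZd_const_mul]
      have h := (hbar x hx).2
      calc V x * (M₂⁻¹ * (S x ^ (-p) + A * S x ^ (-(p + e'))))
          = M₂⁻¹ * (V x * (S x ^ (-p) + A * S x ^ (-(p + e')))) := by ring
        _ ≤ M₂⁻¹ * latticeLaplacianZd (fun y => S y ^ (-p) + A * S y ^ (-(p + e'))) x :=
            mul_le_mul_of_nonneg_left h (inv_nonneg.2 hM₂0.le)
    · intro x hx
      obtain ⟨hx0, -⟩ := adm x (hEadm' x (Or.inl hx))
      rw [hsol x hx0]
    · intro y hy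
      obtain ⟨hyF, hy4⟩ := hbdryF y hy
      obtain ⟨hy0, -⟩ := adm y hy4
      have h := hM₂ y hyF (hGpos y hy0)
      rw [inv_mul_le_iff₀ hM₂0]
      exact h
    · intro ε hε
      have hev' : ∀ᶠ x in cofinite, 2 * M₂⁻¹ * S x ^ (-(1 / 4 : ℝ)) ≤ ε :=
        hStend.eventually (eventually_mul_rpow_neg_le (by norm_num) (2 * M₂⁻¹) hε)
      filter_upwards [hev'] with x hx hxE
      have hx4 : S₀ / 4 ≤ S x := hEadm' x (Or.inl hxE)
      obtain ⟨hx0, hs1, -⟩ := adm x hx4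
      have hs0 : 0 < S x := by linarith
      obtain ⟨-, -, -, hw2⟩ := hwpos x hx4
      have hq : 0 ≤ S x ^ (-(1 / 4 : ℝ)) := Real.rpow_nonneg hs0.le _
      have hsplit : S x ^ (-(1 / 2 : ℝ)) = S x ^ (-(1 / 4 : ℝ)) * S x ^ (-(1 / 4 : ℝ)) := by
        rw [← Real.rpow_add hs0]; norm_num
      have hG0 := hGpos x hx0
      have hMi : 0 ≤ M₂⁻¹ := inv_nonneg.2 hM₂0.le
      calc M₂⁻¹ * (S x ^ (-p) + A * S x ^ (-(p + e'))) - G x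
          ≤ M₂⁻¹ * (2 * S x ^ (-(1 / 2 : ℝ))) := by nlinarith
        _ = 2 * M₂⁻¹ * S x ^ (-(1 / 4 : ℝ)) * S x ^ (-(1 / 4 : ℝ)) := by rw [hsplit]; ring
        _ ≤ ε * S x ^ (-(1 / 4 : ℝ)) := mul_le_mul_of_nonneg_right hx hq
  refine ⟨S₀, M₂⁻¹, M, inv_pos.2 hM₂0, fun x hx => ?_⟩
  have hxE : x ∈ E := (hEmem x).2 hx
  have hx4 : S₀ / 4 ≤ S x := by linarith
  obtain ⟨h1, h2, h3, -⟩ := hwpos x hx4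
  constructor
  · calc M₂⁻¹ * S x ^ (-p) ≤ M₂⁻¹ * (S x ^ (-p) + A * S x ^ (-(p + e'))) :=
          mul_le_mul_of_nonneg_left h3 (inv_nonneg.2 hM₂0.le)
      _ ≤ G x := hlower x hxE
  · calc G x ≤ M * (S x ^ (-p) - A * S x ^ (-(p + e'))) := hupper x hxE
      _ ≤ M * S x ^ (-p) := mul_le_mul_of_nonneg_left h2 hM0.le

/-- **A-priori bounds on all of `ℤ³ ∖ {0}`**: under the hypotheses of `exterior_bounds`,
`c s^{-p} ≤ G ≤ C' s^{-p}` for all `x ≠ 0` (`p = (1 + √(1+4κ))/4`), the finite region `{s < S₀}`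
being absorbed into the constants. [folklore] -/
theorem powerBounds_of_telemetry {κ e C C₀ : ℝ} (hκ : 0 ≤ κ) (he : 0 < e) (hC : 0 ≤ C)
    {G : Site 3 → ℝ} (hGpos : ∀ x : Site 3, x ≠ 0 → 0 < G x)
    (hGup : ∀ x : Site 3, x ≠ 0 → G x ≤ C₀ * (∑ i, ((x i : ℤ) : ℝ) ^ 2) ^ (-(1 / 2 : ℝ)))
    (hT : ∀ x : Site 3, x ≠ 0 →
      |(∑ i, ((x i : ℤ) : ℝ) ^ 2) * (latticeLaplacianZd G x / G x) - κ| ≤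
        C * (∑ i, ((x i : ℤ) : ℝ) ^ 2) ^ (-e)) :
    ∃ c C' : ℝ, 0 < c ∧ 0 < C' ∧ ∀ x : Site 3, x ≠ 0 →
      c * (∑ i, ((x i : ℤ) : ℝ) ^ 2) ^ (-((1 + Real.sqrt (1 + 4 * κ)) / 4)) ≤ G x ∧
      G x ≤ C' * (∑ i, ((x i : ℤ) : ℝ) ^ 2) ^ (-((1 + Real.sqrt (1 + 4 * κ)) / 4)) := by
  obtain ⟨S₀, m, M, hm, hext⟩ := exterior_bounds hκ he hC hGpos hGup hT
  obtain ⟨S, hS⟩ : ∃ S : Site 3 → ℝ, ∀ x, S x = ∑ i, ((x i : ℤ) : ℝ) ^ 2 := ⟨_, fun _ => rfl⟩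
  simp only [← hS] at hext ⊢
  set p : ℝ := (1 + Real.sqrt (1 + 4 * κ)) / 4 with hp
  have hF : {y : Site 3 | S y ≤ S₀}.Finite := by simpa only [← hS] using finite_sumSq_le S₀
  obtain ⟨M₃, hM₃0, hM₃⟩ := exists_le_mul_on_finite hF (fun y => S y ^ (-p)) G
  obtain ⟨M₄, hM₄0, hM₄⟩ := exists_le_mul_on_finite hF G (fun y => S y ^ (-p))
  refine ⟨min m M₃⁻¹, max M M₄, lt_min hm (inv_pos.2 hM₃0), lt_max_of_lt_right hM₄0,
    fun x hx => ?_⟩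
  have hS1 : 1 ≤ S x := by rw [hS]; exact PerfectScreening.one_le_sum_sq hx
  have hSp : 0 < S x ^ (-p) := Real.rpow_pos_of_pos (by linarith) _
  by_cases hxS : S₀ ≤ S x
  · obtain ⟨h1, h2⟩ := hext x hxS
    constructor
    · exact le_trans (mul_le_mul_of_nonneg_right (min_le_left _ _) hSp.le) h1
    · exact h2.trans (mul_le_mul_of_nonneg_right (le_max_left _ _) hSp.le)
  · have hxF : x ∈ {y : Site 3 | S y ≤ S₀} := le_of_lt (not_le.1 hxS)
    constructor
    · have h := hM₃ x hxF (hGpos x hx)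
      calc min m M₃⁻¹ * S x ^ (-p) ≤ M₃⁻¹ * S x ^ (-p) :=
            mul_le_mul_of_nonneg_right (min_le_right _ _) hSp.le
        _ ≤ G x := by rw [inv_mul_le_iff₀ hM₃0]; exact h
    · exact (hM₄ x hxF hSp).trans (mul_le_mul_of_nonneg_right (le_max_right _ _) hSp.le)

end Summit.CriticalPhenomena.Ising3DConformalLimit.Theorems.EtaBoundsFromTelemetry


namespace Summit.CriticalPhenomena.Ising3DConformalLimit.Theorems

open Literature.Probability.LatticeModels Finset Filter Topology
open Summit.CriticalPhenomena.Ising3DConformalLimit.Theorems.EtaBoundsFromTelemetry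

/-- **Item `stmt-CriticalPhenomena-4499` (`EtaBoundsFromTelemetry`), proved.** If the exact effective
potential `V_eff = Δ_{ℤ³}G/G` of the critical two-point function `G = ⟨σ₀σ_x⟩⁺_{β_c}` of the
nearest-neighbour Ising model on `ℤ³` obeys `| |x|₂² V_eff(x) - κ | ≤ C |x|₂^{-ε}` for `x ≠ 0`
(`κ ≥ 0`, `ε > 0`), then `HasIsingEtaBounds 3 η` with `η = α₊(κ) - 1 = (√(1+4κ) - 1)/2 ≥ 0`,
`α₊ = (1 + √(1+4κ))/2` the decaying indicial root of `α(α-1) = κ`. Proof: `G > 0`, `G ≤ C₀‖x‖⁻¹`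
(`criticalTwoPoint_bounds_holds`); the hypothesis is rewritten with `latticeLaplacianZd_three` and
`√s^{-ε} = s^{-ε/2}`; `powerBounds_of_telemetry` (barriers + `h`-transform comparison) gives
`c s^{-α₊/2} ≤ G ≤ C' s^{-α₊/2}`, `s = |x|₂²`, and `‖x‖² ≤ s ≤ 3‖x‖²` exchanges the norms. -/
theorem etaBoundsFromTelemetry_proof :
    Summit.CriticalPhenomena.Ising3DConformalLimit.Theses.InverseSquareTelemetry.EtaBoundsFromTelemetry := by
  unfold Theses.InverseSquareTelemetry.EtaBoundsFromTelemetry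
  rintro ⟨κ, ε, C, hκ, hε, hT⟩
  obtain ⟨c₀, C₀, hc₀, hb⟩ := criticalTwoPoint_bounds_holds (d := 3) le_rfl
  have hGpos : ∀ x : Site 3, x ≠ 0 → 0 < criticalTwoPoint 3 x := fun x hx => by
    have h := (hb x hx).1
    have : 0 < c₀ * ‖x‖ ^ (-(((3 : ℕ) : ℝ) - 1)) :=
      mul_pos hc₀ (Real.rpow_pos_of_pos (PerfectScreening.norm_pos_of_ne_zero hx) _)
    linarith
  have hGup : ∀ x : Site 3, x ≠ 0 → criticalTwoPoint 3 x ≤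
      (|C₀| * Real.sqrt 3) * (∑ i, ((x i : ℤ) : ℝ) ^ 2) ^ (-(1 / 2 : ℝ)) := by
    intro x hx
    have h := (hb x hx).2
    have hn : 0 < ‖x‖ := PerfectScreening.norm_pos_of_ne_zero hx
    rw [show -(((3 : ℕ) : ℝ) - 2) = (-1 : ℝ) by norm_num, Real.rpow_neg_one] at h
    calc criticalTwoPoint 3 x ≤ C₀ * ‖x‖⁻¹ := h
      _ ≤ |C₀| * ‖x‖⁻¹ := mul_le_mul_of_nonneg_right (le_abs_self _) (inv_nonneg.2 hn.le)
      _ ≤ |C₀| * (Real.sqrt 3 * (∑ i, ((x i : ℤ) : ℝ) ^ 2) ^ (-(1 / 2 : ℝ))) :=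
          mul_le_mul_of_nonneg_left (inv_norm_le_sqrt_three_mul_rpow hx) (abs_nonneg _)
      _ = (|C₀| * Real.sqrt 3) * (∑ i, ((x i : ℤ) : ℝ) ^ 2) ^ (-(1 / 2 : ℝ)) := by ring
  have hT' : ∀ x : Site 3, x ≠ 0 →
      |(∑ i, ((x i : ℤ) : ℝ) ^ 2) * (latticeLaplacianZd (criticalTwoPoint 3) x / criticalTwoPoint 3 x) - κ|
        ≤ max C 0 * (∑ i, ((x i : ℤ) : ℝ) ^ 2) ^ (-(ε / 2)) := by
    intro x hx
    have h := hT x hx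
    have hS0 : (0 : ℝ) ≤ ∑ i, ((x i : ℤ) : ℝ) ^ 2 := by positivity
    have e2 : Real.sqrt (∑ i, ((x i : ℤ) : ℝ) ^ 2) ^ (-ε) = (∑ i, ((x i : ℤ) : ℝ) ^ 2) ^ (-(ε / 2)) := by
      rw [Real.sqrt_eq_rpow, ← Real.rpow_mul hS0]; congr 1; ring
    rw [latticeLaplacianZd_three]
    rw [e2] at h
    exact h.trans (mul_le_mul_of_nonneg_right (le_max_left _ _) (Real.rpow_nonneg hS0 _))
  obtain ⟨c, C', hc, hC', hbd⟩ := powerBounds_of_telemetry hκ (half_pos hε) (le_max_right C 0)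
    hGpos hGup hT'
  set r : ℝ := Real.sqrt (1 + 4 * κ) with hr
  have hr1 : 1 ≤ r := by
    simpa only [Real.sqrt_one] using Real.sqrt_le_sqrt (show (1 : ℝ) ≤ 1 + 4 * κ by linarith)
  have hp0 : -((1 + r) / 4) ≤ 0 := by
    have : 0 < (1 + r) / 4 := by linarith
    linarith
  refine ⟨(r - 1) / 2, by linarith, c * 3 ^ (-((1 + r) / 4)), C',
    mul_pos hc (Real.rpow_pos_of_pos (by norm_num) _), fun x hx => ?_⟩
  obtain ⟨h1, h2⟩ := hbd x hx
  have hn : 0 < ‖x‖ := PerfectScreening.norm_pos_of_ne_zero hx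
  have hn2 : 0 < ‖x‖ ^ 2 := by positivity
  have hlow : ‖x‖ ^ 2 ≤ ∑ i, ((x i : ℤ) : ℝ) ^ 2 :=
    (Real.le_sqrt (norm_nonneg _) (by positivity)).1 (PerfectScreening.norm_le_sqrt_sum_sq x)
  have hup : ∑ i, ((x i : ℤ) : ℝ) ^ 2 ≤ 3 * ‖x‖ ^ 2 := PerfectScreening.sum_sq_le_three_mul_norm_sq x
  have hexp : -(((3 : ℕ) : ℝ) - 2 + (r - 1) / 2) = (2 : ℝ) * (-((1 + r) / 4)) := by push_cast; ring
  rw [hexp, Real.rpow_mul (norm_nonneg x), Real.rpow_two]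
  constructor
  · calc c * 3 ^ (-((1 + r) / 4)) * (‖x‖ ^ 2) ^ (-((1 + r) / 4))
        = c * (3 * ‖x‖ ^ 2) ^ (-((1 + r) / 4)) := by
          rw [Real.mul_rpow (by norm_num) hn2.le]; ring
      _ ≤ c * (∑ i, ((x i : ℤ) : ℝ) ^ 2) ^ (-((1 + r) / 4)) :=
          mul_le_mul_of_nonneg_left (Real.rpow_le_rpow_of_nonpos (by linarith) hup hp0) hc.le
      _ ≤ criticalTwoPoint 3 x := h1
  · calc criticalTwoPoint 3 x ≤ C' * (∑ i, ((x i : ℤ) : ℝ) ^ 2) ^ (-((1 + r) / 4)) := h2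
      _ ≤ C' * (‖x‖ ^ 2) ^ (-((1 + r) / 4)) :=
          mul_le_mul_of_nonneg_left (Real.rpow_le_rpow_of_nonpos hn2 hlow hp0) hC'.le

end Summit.CriticalPhenomena.Ising3DConformalLimit.Theorems
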